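import Mathlib
import Summits.Ventures.PercRepro2.Defs
import Summits.Ventures.PercRepro2.Graph
import Summits.Ventures.PercRepro2.HullDefs
import Summits.Ventures.PercRepro2.LocRows
import Summits.Ventures.PercRepro2.SwRow
import Summits.Ventures.PercRepro2.SwGlue2
import Summits.Ventures.PercRepro2.RigidLemma
import Summits.Ventures.PercRepro2.SwEarDefs

/-!
# Auxiliary lemmas for the ear composition (blind cell PercRepro2, night-4 g5, 2026-08-24)

Total extensions of injections on subtypes (`ext`), the class indicators of the ear class, the
edges inside a set on either side of the cut, and the second-side part of a first-side cluster.
-/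

namespace Summit.Ventures.PercRepro2

namespace Ear

open Hull LocRows Glue2 Rigid

open scoped Classical

variable {V : Type*} {E₁ E₂ : Type*}
variable {ends₁ : E₁ → Sym2 V} {ends₂ : E₂ → Sym2 V} {u v : V} {V₁ V₂ : Set V}

/-- Two Booleans that are neither both `false` nor both `true` are complementary. -/
lemma bool_mixed {ρ β : Bool} (hnn : ¬ (ρ = false ∧ β = false)) (htt : ¬ (ρ = true ∧ β = true)) :
    β = !ρ := by
  cases ρ <;> cases β <;> simp_all

/-- A configuration of `G₁ + e` is `addConfig` of its sides. -/
lemma addConfig_sides (η : Config (E₁ ⊕ Unit)) : addConfig (η ∘ Sum.inl) (η (Sum.inr ())) = η := by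
  funext e; rcases e with e | ⟨⟩ <;> rfl

/-- The swap of the second side exchanges the two class indicators. -/
lemma decide_blue_blue (ζ₂ : Config E₂) :
    decide (Conn ends₂ (blue (blue ζ₂)) u v) = decide (Conn ends₂ ζ₂ u v) := by
  rw [blue_blue]

/-- An edge of the first side inside a set lies inside the set's first-side part. -/
lemma mem_within_inl' (hg : IsGluing2 ends₁ ends₂ u v V₁ V₂) {S : Set V} {e : E₁}
    (he : Sum.inl e ∈ within (glue2 ends₁ ends₂) S) : e ∈ within ends₁ (S ∩ V₁) := by
  obtain ⟨x, hx, y, hy, hends⟩ := he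
  refine ⟨x, ⟨hx, hg.mem₁ e x ?_⟩, y, ⟨hy, hg.mem₁ e y ?_⟩, hends⟩
  · rw [show ends₁ e = s(x, y) from hends]; exact Sym2.mem_mk_left x y
  · rw [show ends₁ e = s(x, y) from hends]; exact Sym2.mem_mk_right x y

/-- An edge of the second side inside a set lies inside the set's second-side part. -/
lemma mem_within_inr (hg : IsGluing2 ends₁ ends₂ u v V₁ V₂) {S : Set V} {e : E₂}
    (he : Sum.inr e ∈ within (glue2 ends₁ ends₂) S) : e ∈ within ends₂ (S ∩ V₂) := by
  obtain ⟨x, hx, y, hy, hends⟩ := he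
  refine ⟨x, ⟨hx, hg.mem₂ e x ?_⟩, y, ⟨hy, hg.mem₂ e y ?_⟩, hends⟩
  · rw [show ends₂ e = s(x, y) from hends]; exact Sym2.mem_mk_left x y
  · rw [show ends₂ e = s(x, y) from hends]; exact Sym2.mem_mk_right x y

/-- The second-side part of the red cluster of a first-side vertex lies inside the second-side
clusters of `u` and `v` (whichever the first-side part reaches). -/
lemma cluster_inter_V₂_subset (hg : IsGluing2 ends₁ ends₂ u v V₁ V₂) (huv : u ≠ v)
    {ζ : Config (E₁ ⊕ E₂)} {x : V} (hx : x ∈ V₁) {y : V} (hy : y ∈ cluster (glue2 ends₁ ends₂) ζ x)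
    (hyV₂ : y ∈ V₂) :
    (u ∈ cluster (glue2 ends₁ ends₂) ζ x ∧ y ∈ cluster ends₂ (ζ ∘ Sum.inr) u) ∨
    (v ∈ cluster (glue2 ends₁ ends₂) ζ x ∧ y ∈ cluster ends₂ (ζ ∘ Sum.inr) v) := by
  rw [cluster_glue2_eq_add hg huv hx] at hy ⊢
  simp only [Set.mem_union, Set.mem_setOf_eq] at hy ⊢
  rcases hy with hy | ⟨hu, hy⟩ | ⟨hv, hy⟩
  · have hyV₁ : y ∈ V₁ := cluster_add_subset hg hx hy
    rcases hg.inter y hyV₁ hyV₂ with rfl | rfl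
    · exact Or.inl ⟨Or.inl hy, mem_cluster_self _ _ _⟩
    · exact Or.inr ⟨Or.inl hy, mem_cluster_self _ _ _⟩
  · exact Or.inl ⟨Or.inl hu, hy⟩
  · exact Or.inr ⟨Or.inl hv, hy⟩

variable [Fintype E₁] [DecidableEq E₁] [Fintype E₂] [DecidableEq E₂]

/-- The class indicators of a member of the ear class. -/
lemma earClass_indicators {ζ₂ : Config E₂} (h : ζ₂ ∈ earClass ends₂ u v) :
    decide (Conn ends₂ ζ₂ u v) = false ∧ decide (Conn ends₂ (blue ζ₂) u v) = true := by
  simp only [earClass, Finset.mem_filter, Finset.mem_univ, true_and] at h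
  exact ⟨decide_eq_false_iff_not.2 h.1, decide_eq_true_iff.2 h.2⟩

/-- Membership in the ear class from the indicators. -/
lemma mem_earClass_of_indicators {ζ₂ : Config E₂} (hr : decide (Conn ends₂ ζ₂ u v) = false)
    (hb : decide (Conn ends₂ (blue ζ₂) u v) = true) : ζ₂ ∈ earClass ends₂ u v := by
  simp only [earClass, Finset.mem_filter, Finset.mem_univ, true_and]
  exact ⟨decide_eq_false_iff_not.1 hr, decide_eq_true_iff.1 hb⟩

/-- The total extension of an injection on a subtype of configurations (identity off the domain). -/
noncomputable def ext {E : Type*} (D : Finset (Config E)) (f : {ζ // ζ ∈ D} → Config E) :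
    Config E → Config E := fun ζ => if h : ζ ∈ D then f ⟨ζ, h⟩ else ζ

/-- `ext` agrees with `f` on the domain. -/
lemma ext_of_mem {E : Type*} (D : Finset (Config E)) (f : {ζ // ζ ∈ D} → Config E) {ζ : Config E}
    (h : ζ ∈ D) : ext D f ζ = f ⟨ζ, h⟩ := by simp [ext, h]

/-- `ext` is injective on the domain when `f` is injective. -/
lemma ext_injOn {E : Type*} (D : Finset (Config E)) (f : {ζ // ζ ∈ D} → Config E)
    (hf : Function.Injective f) {ζ ζ' : Config E} (h : ζ ∈ D) (h' : ζ' ∈ D)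
    (heq : ext D f ζ = ext D f ζ') : ζ = ζ' := by
  rw [ext_of_mem D f h, ext_of_mem D f h'] at heq
  exact congrArg Subtype.val (hf heq)

end Ear

end Summit.Ventures.PercRepro2
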